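import Mathlib
import Literature.Computability.Complexity.ExtMonotoneGRankSupport
import Summits.PneNP.PneNP.Theorems.CliqueExtLowerBound.Negative.LoadBearing

/-!
# Route ConvexRankGates, crux `CliqueExtLowerBound` (stmt-PneNP-10682): GRANK gates live over FINITE fields

Support file (`--supports stmt-PneNP-10682`, registered sub-goal `grank_exists_finite_field` of the line
`width-threshold-certificate-sparsity`, lead c11). The GRANK disjunct of the crux basis `Ext s` quantifies over an
ARBITRARY field `F : Type` ("wild constants": real or transcendental entries, any characteristic). We prove that this
freedom buys nothing but field SIZE: every GRANK gate — `g v = 1 ↔ θ ≤ rank_{Frac F[X]} (K₀ + ∑_{vᵢ=1} Xᵢ Kᵢ)`,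
`K₀, Kᵢ ∈ F^{d×d}` — is computed, with the SAME dimension `d` and threshold `θ`, by GRANK data over a FINITE field
(`exists_finite_field`, `isGRankGate_iff_finite`, `grankGates_eq_finiteField`).

Proof (reduction modulo a maximal ideal, [folklore]): the gate function only depends on which monomials occur in the
`θ × θ` minors of the generic symbolic matrix (`le_rank_symbolicMatrix_iff`, Edmonds 1967). Write the data as the
image of GENERIC data (one indeterminate per matrix entry) over `R₀ = ℤ[entries]` under the evaluation `e₀ : R₀ → F`;
the minor coefficients are finitely many elements of `R₀`. Adjoin one more indeterminate sent to the inverse of the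
product `c` of the coefficients that do not vanish in `F` (Rabinowitsch), let `𝔪` be a maximal ideal of
`R = ℤ[entries, y]` containing the kernel of the evaluation, and reduce the generic data modulo `𝔪`: coefficients
vanishing in `F` lie in the kernel, hence vanish in `κ = R ⧸ 𝔪`; the others divide `c`, which is a unit modulo `𝔪`.
Finally `κ` is a field finitely generated as a `ℤ`-algebra, hence finite (`ℤ` is Jacobson — `int_isJacobsonRing`,
proved here — so `κ` is module-finite over `ℤ` by Mathlib's `finite_of_finite_type_of_isJacobsonRing`; a field that is
integral over `ℤ` has positive characteristic, and is then finite over `𝔽_p`).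

Consequence for the crux chain (refutation side, cf. the c5/c7 loophole audits in `Cruxes/CliqueExtLowerBound/NOTES.md`):
a GRANK refutation of `CliqueExtLowerBound` is WLOG a family of poly-dimension symbolic-rank programs over finite
fields `𝔽_q` (with `q` unbounded) — the only "wildness" of the GRANK class is the field size. No new definitions.

References: J. Edmonds, *Systems of distinct representatives and linear algebra*, J. Res. NBS 71B (1967) §5
[Edmonds1967]; the reduction is the standard "spreading out and specialisation" argument (e.g. Bourbaki, Alg. Comm.
V §3.4, Jacobson rings). [folklore]
-/

-- `Summit.PneNP.PneNP.…` duplicates `PneNP` BY DESIGN (single-problem summit).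
set_option linter.dupNamespace false

namespace Summit.PneNP.PneNP.Theorems.CliqueExtLowerBound.GRankFiniteField

open Literature.Computability.Complexity MvPolynomial Matrix

/-! ### `ℤ` is a Jacobson ring; finitely generated fields over `ℤ` are finite -/

/-- **`ℤ` is a Jacobson ring**: every prime ideal is an intersection of maximal ideals (`(p)` is maximal; `(0)` is
the intersection of the infinitely many `(p)`). [folklore] -/
theorem int_isJacobsonRing : IsJacobsonRing ℤ := by
  rw [isJacobsonRing_iff_prime_eq]
  intro P hP
  by_cases hbot : P = ⊥
  · subst hbot
    refine le_antisymm (fun x hx => ?_) Ideal.le_jacobson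
    rw [Ideal.jacobson, Ideal.mem_sInf] at hx
    obtain ⟨p, hpx, hp⟩ := Nat.exists_infinite_primes (x.natAbs + 1)
    have hpZ : Prime (p : ℤ) := Nat.prime_iff_prime_int.mp hp
    have hmax : (Ideal.span {(p : ℤ)}).IsMaximal :=
      PrincipalIdealRing.isMaximal_of_irreducible hpZ.irreducible
    have hxp : x ∈ Ideal.span {(p : ℤ)} := hx ⟨bot_le, hmax⟩
    rw [Ideal.mem_span_singleton] at hxp
    have hx0 : x = 0 := Int.eq_zero_of_abs_lt_dvd hxp (by rw [Int.abs_eq_natAbs]; exact_mod_cast hpx)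
    rw [hx0]
    exact Submodule.zero_mem _
  · haveI := hP
    haveI : P.IsMaximal := IsPrime.to_maximal_ideal hbot
    exact Ideal.jacobson_eq_self_of_isMaximal

/-- **A field finitely generated as a `ℤ`-algebra is finite** (Zariski's lemma over the Jacobson ring `ℤ`: the
field is module-finite over `ℤ`, hence integral, hence of positive characteristic `p`, hence finite over `𝔽_p`).
[folklore] -/
theorem finite_of_field_finiteType_int (K : Type*) [Field K] [inst : Algebra ℤ K] [Algebra.FiniteType ℤ K] :
    Finite K := by
  -- all `ℤ`-algebra structures agree; work with the canonical one
  have hinst : inst = Ring.toIntAlgebra K := Subsingleton.elim _ _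
  subst hinst
  obtain ⟨p, hp⟩ := CharP.exists K
  rcases CharP.char_is_prime_or_zero K p with hprime | h0
  · haveI : Fact p.Prime := ⟨hprime⟩
    letI : Algebra (ZMod p) K := ZMod.algebra K p
    haveI : Algebra.FiniteType (ZMod p) K := Algebra.FiniteType.of_restrictScalars_finiteType ℤ (ZMod p) K
    haveI : Module.Finite (ZMod p) K := finite_of_finite_type_of_isJacobsonRing (ZMod p) K
    exact Module.finite_of_finite (ZMod p)
  · subst h0
    haveI : CharZero K := CharP.charP_to_charZero K
    haveI := int_isJacobsonRing
    haveI : Module.Finite ℤ K := finite_of_finite_type_of_isJacobsonRing ℤ K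
    exact absurd rfl (Ideal.IsMaximal.ne_bot_of_isIntegral_int (⊥ : Ideal K))

/-! ### Generic data and their symbolic matrix -/

section Generic

variable {n d : ℕ}

/-- The symbolic matrix of generic-entry data commutes with any change of coefficients into a field: mapping the
generic symbolic matrix `G₀ + ∑ Xᵢ Gᵢ` (entries in `R[X]`) along `f : R → S` gives the symbolic matrix of the mapped
data. [folklore] -/
theorem map_genericSymbolic {R : Type*} [CommRing R] {S : Type*} [Field S] (f : R →+* S)
    (G₀ : Matrix (Fin d) (Fin d) R) (G : Fin n → Matrix (Fin d) (Fin d) R) :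
    (G₀.map (C : R →+* MvPolynomial (Fin n) R) +
        ∑ i, (X i : MvPolynomial (Fin n) R) • (G i).map (C : R →+* MvPolynomial (Fin n) R)).map
        (MvPolynomial.map f) =
      symbolicPolyMatrix (G₀.map f) (fun i => (G i).map f) := by
  ext a b
  simp [symbolicPolyMatrix, Matrix.map_apply, Matrix.add_apply, Matrix.sum_apply, Matrix.smul_apply,
    map_X, map_C]

/-- Minors of the symbolic matrix of mapped generic data are the mapped generic minors. [folklore] -/
theorem det_submatrix_symbolicPolyMatrix_map {R : Type*} [CommRing R] {S : Type*} [Field S] (f : R →+* S)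
    (G₀ : Matrix (Fin d) (Fin d) R) (G : Fin n → Matrix (Fin d) (Fin d) R) {θ : ℕ} (r c : Fin θ → Fin d) :
    ((symbolicPolyMatrix (G₀.map f) (fun i => (G i).map f)).submatrix r c).det =
      MvPolynomial.map f (((G₀.map (C : R →+* MvPolynomial (Fin n) R) +
        ∑ i, (X i : MvPolynomial (Fin n) R) • (G i).map (C : R →+* MvPolynomial (Fin n) R)).submatrix r c).det) := by
  rw [← map_genericSymbolic f G₀ G, Matrix.submatrix_map, ← RingHom.mapMatrix_apply, ← RingHom.map_det]

/-- Hence the gate function of mapped generic data: `θ ≤ rank` iff some generic `θ`-minor has a monomial, switched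
on in `v`, whose coefficient does not die under `f`. [folklore] -/
theorem le_rank_symbolicMatrix_map_generic_iff {R : Type*} [CommRing R] {S : Type*} [Field S] (f : R →+* S)
    (G₀ : Matrix (Fin d) (Fin d) R) (G : Fin n → Matrix (Fin d) (Fin d) R) (v : Fin n → Bool) (θ : ℕ) :
    θ ≤ (symbolicMatrix (G₀.map f) (fun i => (G i).map f) v).rank ↔
      ∃ (r c : Fin θ → Fin d) (s : Fin n →₀ ℕ),
        f ((((G₀.map (C : R →+* MvPolynomial (Fin n) R) +
          ∑ i, (X i : MvPolynomial (Fin n) R) • (G i).map (C : R →+* MvPolynomial (Fin n) R)).submatrix r c).det).coeff s)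
          ≠ 0 ∧ ∀ i ∈ s.support, v i = true := by
  rw [le_rank_symbolicMatrix_iff]
  refine exists_congr fun r => exists_congr fun c => ?_
  constructor
  · rintro ⟨s, hs, hv⟩
    refine ⟨s, ?_, hv⟩
    rwa [det_submatrix_symbolicPolyMatrix_map, mem_support_iff, coeff_map] at hs
  · rintro ⟨s, hs, hv⟩
    refine ⟨s, ?_, hv⟩
    rwa [det_submatrix_symbolicPolyMatrix_map, mem_support_iff, coeff_map]

end Generic

/-! ### The reduction to a finite field -/

/-- **GRANK data over any field are matched by GRANK data over a finite field** (same dimension, same threshold,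
same Boolean function). [folklore] -/
theorem exists_finite_field {F : Type*} [Field F] {n d : ℕ} (θ : ℕ) (K₀ : Matrix (Fin d) (Fin d) F)
    (K : Fin n → Matrix (Fin d) (Fin d) F) :
    ∃ (κ : Type) (_ : Field κ) (_ : Finite κ) (L₀ : Matrix (Fin d) (Fin d) κ)
      (L : Fin n → Matrix (Fin d) (Fin d) κ),
      ∀ v : Fin n → Bool, (θ ≤ (symbolicMatrix K₀ K v).rank ↔ θ ≤ (symbolicMatrix L₀ L v).rank) := by
  classical
  -- generic data: one indeterminate per entry
  let ι : Type := (Fin d × Fin d) ⊕ (Fin n × Fin d × Fin d)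
  let R₀ : Type := MvPolynomial ι ℤ
  let val : ι → F := Sum.elim (fun ab => K₀ ab.1 ab.2) (fun t => K t.1 t.2.1 t.2.2)
  let e₀ : R₀ →+* F := eval₂Hom (Int.castRingHom F) val
  let G₀ : Matrix (Fin d) (Fin d) R₀ := Matrix.of fun a b => X (Sum.inl (a, b))
  let G : Fin n → Matrix (Fin d) (Fin d) R₀ := fun i => Matrix.of fun a b => X (Sum.inr (i, a, b))
  have hG₀ : G₀.map e₀ = K₀ := by
    ext a b
    simp +zetaDelta only [Matrix.map_apply, Matrix.of_apply, coe_eval₂Hom, eval₂_X, Sum.elim_inl]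
  have hG : (fun i => (G i).map e₀) = K := by
    funext i
    ext a b
    simp +zetaDelta only [Matrix.map_apply, Matrix.of_apply, coe_eval₂Hom, eval₂_X, Sum.elim_inr]
  -- the generic minors and the product of their coefficients that survive in `F`
  let M : Matrix (Fin d) (Fin d) (MvPolynomial (Fin n) R₀) :=
    G₀.map (C : R₀ →+* MvPolynomial (Fin n) R₀) +
      ∑ i, (X i : MvPolynomial (Fin n) R₀) • (G i).map (C : R₀ →+* MvPolynomial (Fin n) R₀)
  let D : (Fin θ → Fin d) × (Fin θ → Fin d) → MvPolynomial (Fin n) R₀ := fun rc => (M.submatrix rc.1 rc.2).det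
  let cR : R₀ := ∏ rc, ∏ s ∈ (D rc).support, (if e₀ ((D rc).coeff s) = 0 then 1 else (D rc).coeff s)
  have hcR : e₀ cR ≠ 0 := by
    simp only [cR, map_prod]
    refine Finset.prod_ne_zero_iff.2 fun rc _ => Finset.prod_ne_zero_iff.2 fun s _ => ?_
    split_ifs with h
    · simp
    · exact h
  have hdvd : ∀ (rc : (Fin θ → Fin d) × (Fin θ → Fin d)) (s : Fin n →₀ ℕ), e₀ ((D rc).coeff s) ≠ 0 →
      (D rc).coeff s ∣ cR := by
    intro rc s hs
    have hsupp : s ∈ (D rc).support := by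
      rw [mem_support_iff]
      intro h0
      exact hs (by rw [h0, map_zero])
    refine dvd_trans ?_ (Finset.dvd_prod_of_mem _ (Finset.mem_univ rc))
    have := Finset.dvd_prod_of_mem (fun s => if e₀ ((D rc).coeff s) = 0 then (1 : R₀) else (D rc).coeff s) hsupp
    simpa only [if_neg hs] using this
  -- Rabinowitsch: adjoin an inverse of `cR`, evaluate, and take a maximal ideal above the kernel
  let R : Type := MvPolynomial (Option ι) ℤ
  let j : R₀ →+* R := (rename (Option.some : ι → Option ι) : R₀ →ₐ[ℤ] R).toRingHom
  let e : R →+* F := eval₂Hom (Int.castRingHom F) (fun o => Option.elim o (e₀ cR)⁻¹ val)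
  have hej : ∀ a : R₀, e (j a) = e₀ a := by
    intro a
    change eval₂ (Int.castRingHom F) (fun o => Option.elim o (e₀ cR)⁻¹ val) (rename some a) = _
    rw [eval₂_rename]
    rfl
  have hX : e (X none) = (e₀ cR)⁻¹ := by
    simp +zetaDelta only [coe_eval₂Hom, eval₂_X, Option.elim_none]
  have hunit : e (j cR * X none - 1) = 0 := by
    rw [map_sub, map_mul, hej, map_one, hX, mul_inv_cancel₀ hcR, sub_self]
  obtain ⟨𝔪, h𝔪, hP𝔪⟩ := Ideal.exists_le_maximal (RingHom.ker e) (RingHom.ker_ne_top e)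
  let κ : Type := R ⧸ 𝔪
  letI : Field κ := Ideal.Quotient.field 𝔪
  let π : R →+* κ := Ideal.Quotient.mk 𝔪
  let π₀ : R₀ →+* κ := π.comp j
  haveI : Finite κ := finite_of_field_finiteType_int κ
  -- coefficients: vanishing in `F` iff vanishing in `κ`
  have hcRκ : π₀ cR ≠ 0 := by
    intro h0
    have h1 : π (j cR * X none - 1) = 0 := Ideal.Quotient.eq_zero_iff_mem.2 (hP𝔪 hunit)
    rw [map_sub, map_mul, map_one, sub_eq_zero] at h1
    have : π (j cR) = 0 := h0
    rw [this, zero_mul] at h1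
    exact zero_ne_one h1
  have key : ∀ (rc : (Fin θ → Fin d) × (Fin θ → Fin d)) (s : Fin n →₀ ℕ),
      e₀ ((D rc).coeff s) ≠ 0 ↔ π₀ ((D rc).coeff s) ≠ 0 := by
    intro rc s
    constructor
    · intro hs h0
      obtain ⟨t, ht⟩ := hdvd rc s hs
      apply hcRκ
      rw [ht, map_mul, h0, zero_mul]
    · intro hs h0
      apply hs
      have hmem : j ((D rc).coeff s) ∈ RingHom.ker e := by
        rw [RingHom.mem_ker, hej, h0]
      exact Ideal.Quotient.eq_zero_iff_mem.2 (hP𝔪 hmem)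
  -- the reduced data
  refine ⟨κ, inferInstance, inferInstance, G₀.map π₀, fun i => (G i).map π₀, fun v => ?_⟩
  rw [← hG₀, ← hG, le_rank_symbolicMatrix_map_generic_iff, le_rank_symbolicMatrix_map_generic_iff]
  refine exists_congr fun r => exists_congr fun c => exists_congr fun s => and_congr_left fun _ => ?_
  exact key (r, c) s

/-- **GRANK gates live over finite fields.** `IsGRankGate s g` iff `g` is a generic-rank threshold gate of
dimension `≤ s` over some FINITE field. [folklore] -/
theorem isGRankGate_iff_finite {s : ℕ} {g : GateFn} : IsGRankGate s g ↔
    ∃ (F : Type) (_ : Field F) (_ : Finite F) (d θ : ℕ), d ≤ s ∧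
      ∃ (K₀ : Matrix (Fin d) (Fin d) F) (K : Fin g.1 → Matrix (Fin d) (Fin d) F),
        ∀ v : Fin g.1 → Bool, g.2 v = true ↔ θ ≤ (symbolicMatrix K₀ K v).rank := by
  constructor
  · rintro ⟨F, _, d, θ, hd, K₀, K, hg⟩
    obtain ⟨κ, _, _, L₀, L, hL⟩ := exists_finite_field θ K₀ K
    exact ⟨κ, inferInstance, inferInstance, d, θ, hd, L₀, L, fun v => (hg v).trans (hL v)⟩
  · rintro ⟨F, _, _, d, θ, hd, K₀, K, hg⟩
    exact ⟨F, inferInstance, d, θ, hd, K₀, K, hg⟩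

/-- **The GRANK class of the crux basis is the finite-field GRANK class** (as sets of gate functions, for every
size parameter `s`): the `∃ (F : Type) [Field F]` in `Ext s` / `extGate s` may be read over finite fields only.
[folklore] -/
theorem grankGates_eq_finiteField (s : ℕ) : {g : GateFn | IsGRankGate s g} =
    {g : GateFn | ∃ (F : Type) (_ : Field F) (_ : Finite F) (d θ : ℕ), d ≤ s ∧
      ∃ (K₀ : Matrix (Fin d) (Fin d) F) (K : Fin g.1 → Matrix (Fin d) (Fin d) F),
        ∀ v : Fin g.1 → Bool, g.2 v = true ↔ θ ≤ (symbolicMatrix K₀ K v).rank} :=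
  Set.ext fun _ => isGRankGate_iff_finite

/-! ### Consequences for the crux basis -/

/-- **The extended monotone basis with finite-field GRANK gates.** `extGate s` (= the inline `Ext s` of the crux,
`Negative.inlineExt_eq_extGate`) equals the same basis with the GRANK disjunct read over FINITE fields. [folklore] -/
theorem extGate_eq_finiteField (s : ℕ) : extGate s =
    {GateFn.and 2, GateFn.or 2} ∪ {g | IsConvGate s g ∨ IsPermGate s g ∨
      ∃ (F : Type) (_ : Field F) (_ : Finite F) (d θ : ℕ), d ≤ s ∧
        ∃ (K₀ : Matrix (Fin d) (Fin d) F) (K : Fin g.1 → Matrix (Fin d) (Fin d) F),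
          ∀ v : Fin g.1 → Bool, g.2 v = true ↔ θ ≤ (symbolicMatrix K₀ K v).rank} := by
  ext g
  simp only [extGate, Set.mem_union, Set.mem_setOf_eq, isGRankGate_iff_finite]

open Filter Summit.PneNP.PneNP.Theorems.CliqueExtLowerBound.Negative in
open Classical in
/-- **The crux over the finite-field basis.** `CliqueExtLowerBound` is equivalent to the same lower bound for
circuits over `{∧₂, ∨₂} ∪ CONV_{m^c} ∪ PERM_{m^c} ∪ GRANK_{m^c}(finite fields)`: restricting the field of every
GRANK gate to be finite changes neither the basis nor the crux. (So a refutation through GRANK gates is WLOG a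
family of poly-dimension symbolic-rank programs over finite fields `𝔽_q`, `q` unbounded; a proof may assume every
GRANK gate finite-field.) [folklore] -/
theorem cliqueExtLowerBound_iff_finiteFieldBasis :
    Summit.PneNP.PneNP.Theses.ConvexRankGates.CliqueExtLowerBound ↔
    ∃ δ : ℝ, 0 < δ ∧ δ < 1 / 2 ∧ ∀ c : ℕ, ∀ᶠ m : ℕ in atTop,
      ∀ C : Circuit ((⊤ : SimpleGraph (Fin m)).edgeSet),
        C.IsOver ({GateFn.and 2, GateFn.or 2} ∪ {g | IsConvGate (m ^ c) g ∨ IsPermGate (m ^ c) g ∨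
          ∃ (F : Type) (_ : Field F) (_ : Finite F) (d θ : ℕ), d ≤ m ^ c ∧
            ∃ (K₀ : Matrix (Fin d) (Fin d) F) (K : Fin g.1 → Matrix (Fin d) (Fin d) F),
              ∀ v : Fin g.1 → Bool, g.2 v = true ↔ θ ≤ (symbolicMatrix K₀ K v).rank}) →
        C.size ≤ m ^ c → ¬ C.Computes (cliqueFn m ⌈(m : ℝ) ^ δ⌉₊) := by
  rw [cliqueExtLowerBound_iff]
  simp only [LowerBoundAt, extGate_eq_finiteField]

/-- Registered sub-goal `grankGate_iff_finiteField` of the line skeleton (`Lines/width_threshold_certificate_sparsity.lean`,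
lead c11): GRANK gates of the crux basis are exactly the finite-field GRANK gates. [folklore] -/
theorem grankGate_iff_finiteField : ∀ (s : ℕ) (g : GateFn), IsGRankGate s g ↔
    ∃ (F : Type) (_ : Field F) (_ : Finite F) (d θ : ℕ), d ≤ s ∧
      ∃ (K₀ : Matrix (Fin d) (Fin d) F) (K : Fin g.1 → Matrix (Fin d) (Fin d) F),
        ∀ v : Fin g.1 → Bool, g.2 v = true ↔ θ ≤ (symbolicMatrix K₀ K v).rank :=
  fun _ _ => isGRankGate_iff_finite

end Summit.PneNP.PneNP.Theorems.CliqueExtLowerBound.GRankFiniteField
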